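/-
Copyright: the b2b-balaban T⁴-continuum CRUX team, row NE7b OWNER lineage `t4-ne7b-p1` (gen 124). Project licence.
-/
import Summits.QuantumFields.BalabanUV.T4Continuum.Spine.NE7b.SupZdCoarseInverse

/-!
# THE PROFILE LEMMA WITHOUT RATE LOSS: on `ℤ^d` (`V : ℤ^d → [−λ, Λ]`, `d ≥ 3`, every mesh) a source with exponential block profile
# `|f(p)| ≤ Me^{−γ|blk n p − b₀|₁}` of ANY rate `γ` strictly below (180)'s block-source decay rate `δ₀` has THE bounded solution with the
# SAME rate: `|u(p)| ≤ C·K_{δ₀−γ}·M·e^{−γ|blk n p − b₀|₁}`, `(C, δ₀)` from `(d, a, λ, Λ)` ONLY — block superposition of (180)'s decaying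
# solutions and the convolution of two exponentials of DIFFERENT rates, which keeps the slower one.  (182)∕(154) return `min(κ, γ∕2)`;
# this no-loss version is what a Neumann iteration for `(H_V + K)⁻¹`'s decay needs (row NE7b, node U5c; (180)∕(181)∕(189) BY NAME; [folklore])

Cell `pub-balaban`, sub-cell `t4`, spine estimate NE7b (`T4WeightBudget.RelWeightBound`; the cell's OWN estimate — NOT PRINTED in
[Bałaban 1983–89], NOT PROVED).  Crux-route work under `Spine/NE7b/` by the row OWNER (`t4-ne7b-p1` gen 124, file (214)) under FREEZE
(0)'s crux-prover clause; NOTHING of Bałaban's is named as a Lean object, valued or asserted; no `T4Continuum/Support` leaf typed; no `def`,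
no notation; zero `sorry`.  Imports (BY NAME): the OWNER's (194) `…SupZdCoarseInverse` (`l1_triangle`; through it (189) `summable_exp_l1`,
`tsum_exp_l1_le`, (181) `zd_bounded_solution_unique`, (180) `zd_propagator_exists`), Mathlib's `Summable.tsum_finsetSum ∕ tsum_mul_left ∕
tsum_add ∕ tsum_sub`, `norm_tsum_le_tsum_norm`, `tsum_eq_single`.

WHY (located).  § [NE7bP1-G124-HANDOFF] NEXT (3)(a): the decay of `G_K = (H_V + K)⁻¹` on `ℤ^d` ((213) has existence) by the Neumann
iteration `u_{j+1} = −H_V⁻¹Ku_j` requires a profile bound whose output rate equals its input rate — (182)'s `min(κ, γ∕2)` halves it each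
step (dead end recorded).  The loss is not intrinsic: write `f = Σ_c f𝟙_{B n c}`, each piece of size `Me^{−γ|c − b₀|₁}`; (180) solves each
with decay `Ce^{−δ₀|blk n p − c|₁}`; the series converges absolutely, solves `H_Vu = f` (the finite stencil through the series, (196)'s
pattern) and is THE bounded solution ((181)); and `Σ_c e^{−δ₀|x − c|₁}e^{−γ|c − b₀|₁} ≤ K_{δ₀−γ}e^{−γ|x − b₀|₁}` for `γ < δ₀` (triangle
inequality in the SLOWER exponential, (189) sums the faster).

WHAT IS PROVED ([folklore]): §1 **`tsum_exp_conv_noLoss`** (`γ < δ` ⟹ summable and `Σ′_ce^{−δ|x−c|₁}e^{−γ|c−b₀|₁} ≤ K_{δ−γ}e^{−γ|x−b₀|₁}`); §2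
**`zd_profile_noLoss`** (THE END: `∃ C δ₀ > 0`: for ALL `n, V`, `0 < γ < δ₀`, `b₀`, sources of profile `Me^{−γ|blk n · − b₀|₁}` and bounded
solutions `u`: `|u(p)| ≤ CK_{δ₀−γ}Me^{−γ|blk n p − b₀|₁}`); §3 toy.

HONEST (what this is NOT).  Rates strictly below `δ₀` (at `γ = δ₀` a polynomial loss is genuine); the LINEAR column only; `d ≥ 3` only;
scalar skeleton ((A3), NC-NE7b-α UNRULED); nothing of the covariant propagators of [B4]–[B6]; nothing of Bałaban's asserted.  BY-NAME EFFECT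
ON THE WALL: NONE.  NE7b NOT PRINTED ∕ NOT PROVED; spine PROVED 0∕9; rung (B)+1 — the programme's measures remain FINITE-torus statements;
NOT the mass gap, NOT Clay.  HONEST DEPENDENCY: continuum YM on T⁴ ⇐ BetaPertH ∧ nine spine estimates (0∕9 proved); BetaPertH ⇐ (D1) ∧
(D4) ∧ CAP+tail; G-an2-4 gates asym, D1 and NE2∕3∕4.
-/

set_option autoImplicit false

noncomputable section

namespace Summit.QuantumFields.BalabanUV.T4Continuum.NE7b.SupZdProfileNoLoss

open Real Filter Topology
open Literature.MathematicalPhysics.QuantumFieldTheory.Balaban1983to89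
open B6QGQLower276 (X e blk B side chart mem_B sum_B sum_B_const card_cube blk_chart)
open SupZdPropagatorLimit (zd_propagator_exists)
open SupZdPropagatorUniqueness (zd_bounded_solution_unique)
open SupZdExponentialSums (summable_exp_l1 tsum_exp_l1_le)
open SupZdCoarseForm (natAbs_sub_comm_sum)
open SupZdCoarseInverse (l1_triangle)

variable {d : ℕ}

/-! ## §1. Convolution of two exponentials with DIFFERENT rates keeps the slower rate -/

/-- **NO-LOSS CONVOLUTION**: `γ < δ` ⟹ `Σ′_c e^{−δ|x − c|₁}e^{−γ|c − b₀|₁} ≤ K_{δ−γ}·e^{−γ|x − b₀|₁}` — `e^{−γ|c−b₀|₁} ≤ e^{−γ|x−b₀|₁}e^{γ|x−c|₁}`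
(triangle) and (189) sums `e^{−(δ−γ)|x−c|₁}`. [folklore] -/
theorem tsum_exp_conv_noLoss {γ δ : ℝ} (hγ : 0 ≤ γ) (hγδ : γ < δ) (b₀ x : X d) :
    Summable (fun c : X d => exp (-(δ * ∑ i, (((x i - c i).natAbs : ℕ) : ℝ))) * exp (-(γ * ∑ i, (((c i - b₀ i).natAbs : ℕ) : ℝ)))) ∧
    ∑' c : X d, exp (-(δ * ∑ i, (((x i - c i).natAbs : ℕ) : ℝ))) * exp (-(γ * ∑ i, (((c i - b₀ i).natAbs : ℕ) : ℝ)))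
      ≤ (2 * (1 - exp (-(δ - γ)))⁻¹) ^ d * exp (-(γ * ∑ i, (((x i - b₀ i).natAbs : ℕ) : ℝ))) := by
  have hdg : 0 < δ - γ := by linarith
  have hpt : ∀ c : X d, exp (-(δ * ∑ i, (((x i - c i).natAbs : ℕ) : ℝ))) * exp (-(γ * ∑ i, (((c i - b₀ i).natAbs : ℕ) : ℝ)))
      ≤ exp (-(γ * ∑ i, (((x i - b₀ i).natAbs : ℕ) : ℝ))) * exp (-((δ - γ) * ∑ i, (((x i - c i).natAbs : ℕ) : ℝ))) := by
    intro c
    rw [← exp_add, ← exp_add]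
    refine exp_le_exp.2 ?_
    have htri := l1_triangle x c b₀
    have h0 : (0 : ℝ) ≤ ∑ i, (((x i - c i).natAbs : ℕ) : ℝ) := by positivity
    nlinarith
  have hs2 : Summable fun c : X d => exp (-(γ * ∑ i, (((x i - b₀ i).natAbs : ℕ) : ℝ)))
      * exp (-((δ - γ) * ∑ i, (((x i - c i).natAbs : ℕ) : ℝ))) := (summable_exp_l1 hdg x).mul_left _
  have hs1 : Summable fun c : X d => exp (-(δ * ∑ i, (((x i - c i).natAbs : ℕ) : ℝ)))
      * exp (-(γ * ∑ i, (((c i - b₀ i).natAbs : ℕ) : ℝ))) := Summable.of_nonneg_of_le (fun c => by positivity) hpt hs2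
  refine ⟨hs1, (hs1.tsum_le_tsum hpt hs2).trans ?_⟩
  rw [(summable_exp_l1 hdg x).tsum_mul_left, mul_comm]
  exact mul_le_mul_of_nonneg_right (tsum_exp_l1_le hdg x) (exp_pos _).le

/-! ## §2. THE END: a source with exponential block profile of rate `γ < δ₀` has THE bounded solution with the SAME rate -/

/-- **HEADLINE — THE PROFILE LEMMA WITHOUT RATE LOSS**: `d ≥ 3`, `a > 0`, `λ < min(2,a)`, `Λ ≥ 0` ⟹ `∃ C δ₀ > 0` (from `(d, a, λ, Λ)` ONLY; `δ₀` =
(180)'s block-source decay rate) such that for ALL `n`, `V : ℤ^d → [−λ, Λ]`, every rate `0 < γ < δ₀`, block `b₀`, and source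
`|f(p)| ≤ M·e^{−γ|blk n p − b₀|₁}`: every BOUNDED solution `u` of `H_Vu = f` satisfies `|u(p)| ≤ C·K_{δ₀−γ}·M·e^{−γ|blk n p − b₀|₁}` —
the SAME rate `γ` ((182) returns `min(κ, γ∕2)`): block superposition of (180)'s decaying block solutions (the piece on block `c` has size
`Me^{−γ|c−b₀|₁}`), the series solving the equation as in (196), §1 for the sum, (181) uniqueness. [folklore] -/
theorem zd_profile_noLoss (hd : 3 ≤ d) (a : ℝ) (ha : 0 < a) {lam Lam : ℝ} (hlam : lam < min 2 a) (hLam : 0 ≤ Lam) :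
    ∃ C δ₀ : ℝ, 0 < C ∧ 0 < δ₀ ∧ ∀ (n : ℕ) (V : X d → ℝ), (∀ p, -lam ≤ V p) → (∀ p, V p ≤ Lam) →
      ∀ (γ : ℝ), 0 < γ → γ < δ₀ → ∀ (b₀ : X d) (M : ℝ) (f : X d → ℝ),
      (∀ p, |f p| ≤ M * exp (-(γ * ∑ i, (((blk n p i - b₀ i).natAbs : ℕ) : ℝ)))) →
      ∀ (u : X d → ℝ) (Bu : ℝ), (∀ p, |u p| ≤ Bu) →
      (∀ p, ((n : ℝ) + 1) ^ 2 * ∑ μ, (2 * u p - u (p + e μ) - u (p - e μ))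
        + a / ((n : ℝ) + 1) ^ d * ∑ q ∈ B n (blk n p), u q + V p * u p = f p) →
      ∀ p, |u p| ≤ C * (2 * (1 - exp (-(δ₀ - γ)))⁻¹) ^ d * M * exp (-(γ * ∑ i, (((blk n p i - b₀ i).natAbs : ℕ) : ℝ))) := by
  classical
  obtain ⟨C, δ₀, hC, hδ₀, H180⟩ := zd_propagator_exists (d := d) hd a ha hlam hLam
  refine ⟨C, δ₀, hC, hδ₀, ?_⟩
  intro n V hV hV' γ hγ hγδ b₀ M f hf u Bu huB hu p
  set Kc : ℝ := (2 * (1 - exp (-(δ₀ - γ)))⁻¹) ^ d with hKc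
  have hKc0 : 0 < Kc := pow_pos (mul_pos two_pos (inv_pos.2 (sub_pos.2 (exp_lt_one_iff.2 (by linarith))))) d
  have hM : 0 ≤ M := by
    have h1 := (abs_nonneg _).trans (hf p)
    exact le_of_mul_le_mul_right (by rw [zero_mul]; exact h1) (exp_pos _)
  -- the block pieces of `f`: the piece on block `c` has size `M e^{−γ|c − b₀|₁}`
  have hpiece : ∀ c q, |(if blk n q = c then f q else 0)| ≤ M * exp (-(γ * ∑ i, (((c i - b₀ i).natAbs : ℕ) : ℝ))) := by
    intro c q
    split_ifs with h
    · rw [← h]; exact hf q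
    · rw [abs_zero]; positivity
  have hex : ∀ c : X d, ∃ w : X d → ℝ,
      (∀ q, ((n : ℝ) + 1) ^ 2 * ∑ μ, (2 * w q - w (q + e μ) - w (q - e μ))
        + a / ((n : ℝ) + 1) ^ d * ∑ q' ∈ B n (blk n q), w q' + V q * w q = if blk n q = c then f q else 0) ∧
      (∀ q, exp (δ₀ * ∑ i, (((blk n q i - c i).natAbs : ℕ) : ℝ)) * |w q| ≤ C * (M * exp (-(γ * ∑ i, (((c i - b₀ i).natAbs : ℕ) : ℝ))))) :=
    fun c => H180 n V hV hV' c _ (fun q => if blk n q = c then f q else 0) (fun q hq => if_neg hq) (hpiece c)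
  choose w hw hwdec using hex
  have hwle : ∀ c q, |w c q| ≤ C * M * (exp (-(δ₀ * ∑ i, (((blk n q i - c i).natAbs : ℕ) : ℝ)))
      * exp (-(γ * ∑ i, (((c i - b₀ i).natAbs : ℕ) : ℝ)))) := by
    intro c q
    have h := hwdec c q
    have hE := exp_pos (δ₀ * ∑ i, (((blk n q i - c i).natAbs : ℕ) : ℝ))
    have h' : |w c q| ≤ C * (M * exp (-(γ * ∑ i, (((c i - b₀ i).natAbs : ℕ) : ℝ)))) * exp (-(δ₀ * ∑ i, (((blk n q i - c i).natAbs : ℕ) : ℝ))) := by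
      rw [exp_neg (δ₀ * _), ← div_eq_mul_inv, le_div_iff₀ hE, mul_comm]; exact h
    calc |w c q| ≤ C * (M * exp (-(γ * ∑ i, (((c i - b₀ i).natAbs : ℕ) : ℝ)))) * exp (-(δ₀ * ∑ i, (((blk n q i - c i).natAbs : ℕ) : ℝ))) := h'
      _ = _ := by ring
  -- absolute convergence of `Σ′_c w_c(q)` with the no-loss profile bound (§1)
  have hs : ∀ q, Summable fun c : X d => w c q := fun q =>
    Summable.of_norm_bounded (((tsum_exp_conv_noLoss hγ.le hγδ b₀ (blk n q)).1).mul_left (C * M)) fun c => by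
      rw [Real.norm_eq_abs]; exact hwle c q
  have hbd : ∀ q, |∑' c : X d, w c q| ≤ C * Kc * M * exp (-(γ * ∑ i, (((blk n q i - b₀ i).natAbs : ℕ) : ℝ))) := by
    intro q
    obtain ⟨hcs, hcb⟩ := tsum_exp_conv_noLoss hγ.le hγδ b₀ (blk n q)
    have h1 : |∑' c : X d, w c q| ≤ ∑' c : X d, |w c q| := by
      have := norm_tsum_le_tsum_norm (hs q).norm; simpa only [Real.norm_eq_abs] using this
    have h2 := (hs q).abs.tsum_le_tsum (hwle · q) (hcs.mul_left (C * M))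
    rw [Summable.tsum_mul_left _ hcs] at h2
    have h3 := mul_le_mul_of_nonneg_left hcb (show 0 ≤ C * M by positivity)
    rw [← hKc] at h3
    calc |∑' c : X d, w c q| ≤ C * M * (Kc * exp (-(γ * ∑ i, (((blk n q i - b₀ i).natAbs : ℕ) : ℝ)))) := h1.trans (h2.trans h3)
      _ = _ := by ring
  -- the series solves the equation (the finite stencil through the absolutely convergent series, as in (196))
  have hWeq : ∀ q, ((n : ℝ) + 1) ^ 2 * ∑ μ, (2 * (∑' c : X d, w c q) - (∑' c : X d, w c (q + e μ)) - (∑' c : X d, w c (q - e μ)))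
      + a / ((n : ℝ) + 1) ^ d * ∑ q' ∈ B n (blk n q), (∑' c : X d, w c q') + V q * (∑' c : X d, w c q) = f q := by
    intro q
    have hpt : ∑' c : X d, (((n : ℝ) + 1) ^ 2 * ∑ μ, (2 * w c q - w c (q + e μ) - w c (q - e μ))
        + a / ((n : ℝ) + 1) ^ d * ∑ q' ∈ B n (blk n q), w c q' + V q * w c q) = f q := by
      simp only [hw]
      rw [tsum_eq_single (blk n q) (fun c hc => by rw [if_neg (Ne.symm hc)]), if_pos rfl]
    have hS1 : ∀ μ : Fin d, Summable fun c : X d => 2 * w c q - w c (q + e μ) - w c (q - e μ) :=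
      fun μ => (((hs q).mul_left 2).sub (hs (q + e μ))).sub (hs (q - e μ))
    have hS1s : Summable fun c : X d => ∑ μ, (2 * w c q - w c (q + e μ) - w c (q - e μ)) := summable_sum fun μ _ => hS1 μ
    have hS2 : Summable fun c : X d => ∑ q' ∈ B n (blk n q), w c q' := summable_sum fun q' _ => hs q'
    have hT1 : ∑' c : X d, ∑ μ, (2 * w c q - w c (q + e μ) - w c (q - e μ))
        = ∑ μ, (2 * (∑' c : X d, w c q) - (∑' c : X d, w c (q + e μ)) - (∑' c : X d, w c (q - e μ))) := by
      rw [Summable.tsum_finsetSum fun μ _ => hS1 μ]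
      refine Finset.sum_congr rfl fun μ _ => ?_
      rw [(((hs q).mul_left 2).sub (hs (q + e μ))).tsum_sub (hs (q - e μ)), ((hs q).mul_left 2).tsum_sub (hs (q + e μ)),
        (hs q).tsum_mul_left 2]
    have hT2 : ∑' c : X d, ∑ q' ∈ B n (blk n q), w c q' = ∑ q' ∈ B n (blk n q), ∑' c : X d, w c q' :=
      Summable.tsum_finsetSum fun q' _ => hs q'
    have hmain : ∑' c : X d, (((n : ℝ) + 1) ^ 2 * ∑ μ, (2 * w c q - w c (q + e μ) - w c (q - e μ))
        + a / ((n : ℝ) + 1) ^ d * ∑ q' ∈ B n (blk n q), w c q' + V q * w c q)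
        = ((n : ℝ) + 1) ^ 2 * ∑' c : X d, ∑ μ, (2 * w c q - w c (q + e μ) - w c (q - e μ))
          + a / ((n : ℝ) + 1) ^ d * ∑' c : X d, ∑ q' ∈ B n (blk n q), w c q' + V q * ∑' c : X d, w c q := by
      rw [Summable.tsum_add ((hS1s.mul_left _).add (hS2.mul_left _)) ((hs q).mul_left _),
        Summable.tsum_add (hS1s.mul_left _) (hS2.mul_left _), hS1s.tsum_mul_left (((n : ℝ) + 1) ^ 2),
        hS2.tsum_mul_left (a / ((n : ℝ) + 1) ^ d), (hs q).tsum_mul_left (V q)]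
    rw [hmain, hT1, hT2] at hpt
    exact hpt
  -- (181): `u` IS the series
  have hB2 : ∀ q, |∑' c : X d, w c q| ≤ C * Kc * M := fun q =>
    (hbd q).trans (mul_le_of_le_one_right (by positivity) (exp_le_one_iff.2 (neg_nonpos.2 (by positivity))))
  have huW : u = fun q => ∑' c : X d, w c q :=
    zd_bounded_solution_unique hd a ha hlam hLam n V hV hV' f u (fun q => ∑' c : X d, w c q) huB hB2 hu hWeq
  rw [huW]
  exact hbd p

/-! ## §3. Toy -/

/-- Toy (`d = 2`, `γ = 1 < δ = 2`): the no-loss convolution around the origin is summable. -/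
example : Summable (fun c : X 2 => exp (-(2 * ∑ i, ((((0 : X 2) i - c i).natAbs : ℕ) : ℝ)))
    * exp (-(1 * ∑ i, (((c i - (0 : X 2) i).natAbs : ℕ) : ℝ)))) :=
  (tsum_exp_conv_noLoss (d := 2) zero_le_one (by norm_num) 0 0).1

end Summit.QuantumFields.BalabanUV.T4Continuum.NE7b.SupZdProfileNoLoss
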